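import Mathlib
import Summits.AtomisticToContinuum.FouriersLaw.Theses.EmbeddedDrudeMourre
import Summits.AtomisticToContinuum.FouriersLaw.Theorems.EmbeddedDrudeMourreDrudeDissolutionCubeOfCutoffFamily
import Summits.AtomisticToContinuum.FouriersLaw.Theorems.EmbeddedDrudeMourreDrudeDissolutionSecondDifferenceOfCube
import Summits.AtomisticToContinuum.FouriersLaw.Theorems.EmbeddedDrudeMourreDrudeDissolutionCutoffArguments
import Summits.AtomisticToContinuum.FouriersLaw.Theorems.EmbeddedDrudeMourreDrudeDissolutionWeightStructure
import Summits.AtomisticToContinuum.FouriersLaw.Theorems.EmbeddedDrudeMourreDrudeDissolutionResonanceStructure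
import Summits.AtomisticToContinuum.FouriersLaw.Theorems.EmbeddedDrudeMourreDrudeDissolutionStubExcursionSecondDifferenceDiscardIntegral
import Summits.AtomisticToContinuum.FouriersLaw.Theorems.EmbeddedDrudeMourreDrudeDissolutionStubExcursionSecondDifferenceWCornerBounds
import Summits.AtomisticToContinuum.FouriersLaw.Theorems.EmbeddedDrudeMourreDrudeDissolutionStubExcursionSecondDifferenceTubeComovingConcrete
import Summits.AtomisticToContinuum.FouriersLaw.Theorems.EmbeddedDrudeMourreDrudeDissolutionStubExcursionSecondDifferenceConcreteRegularity
import HarnessLib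

/-!
# The cube second-difference estimate from the sup bound alone (item C8 of stub B1b″, plumbing)
(crux `EmbeddedDrudeMourre.DrudeDissolution`, item stmt-AtomisticToContinuum-12593; line
`kinetic-polymer-gas-on-the-time-axis`; `--supports` file, closes nothing; lead c13)

WHAT (`excursionCube_of_supBound`, registered). For the concrete data of stub B1b″ — `Ω = resonanceFn` read on the
cell at `p = (k₁,(k₃,k₂))`, the excursion weight `W` of a sine polynomial profile, the sheet amplitude `A = 8H/Q`, the
half-angle sines `S₁, S₂`, `D = |∇Ω|²`, the fluxes `Xⱼ = ∂ⱼΩ/D` (all as free functions with defining hypotheses, the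
convention of the twin files) — the ONLY remaining analytic input is the sup bound (item C6):
for some `K ≥ 0`, `0 < η₀ ≤ 1` and every `0 < η ≤ η₀` a `C²` cutoff `Θ` with the properties of `exists_cutoff_family`
(values in `[0,1]`, `2π`-periodic, `≡ 0` near `{some ρₖ < η²}`, `= 1` on `{all ρₖ ≥ 4η²}`) such that
`|Σⱼ ∂ⱼ(L_G · Xⱼ)| ≤ K/η²`, `L_G = Σⱼ ∂ⱼ(W Θ Xⱼ)`. GIVEN that, the cube estimate
`|∫_cell W·(2φ∘Ω − φ∘(Ω+δ) − φ∘(Ω−δ))| ≤ C δ^{1+α}` holds for all continuous `|φ| ≤ 1` (with `α = 1/3`), i.e. the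
hypothesis of `stub_excursionSecondDifference_of_cube` (p151714).

HOW. `cube_secondDiff_of_cutoffFamily` (p155146) with every other hypothesis discharged from landed facts: regularity and
periodicity of `Ω`, `W` (`resonanceFn_cell_contDiff/periodic`, `excursionWeight_contDiff/periodic`), the support clause
from `cutoff_arguments_zero` (p158836), and the discarded mass `≤ C_d η⁴` from `discard_integral_le` (p159366) fed by
`weight_structure_bounds` (p158458), `weight_corner_bounds` (p158640) and the co-moving tube bounds (p158216).
-/

noncomputable section

open MeasureTheory Set Real Filter Topology
open Literature.MathematicalPhysics.KineticTheory
open Literature.MathematicalPhysics.KineticTheory.PhononBoltzmann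

namespace Summit.AtomisticToContinuum.FouriersLaw.Theorems.DrudeDissolution.KineticPolymerGasOnTheTimeAxis

/-- **Registered sub-goal `excursionCube_of_supBound` (item C8 of stub B1b″, plumbing): the cube second-difference
estimate follows from the sup bound (C6) alone.** See the module docstring. [folklore] -/
theorem excursionCube_of_supBound :
    ∀ ω₂ a b : ℝ, 0 < ω₂ → ∀ (M : ℕ) (c : Fin M → ℝ) (f : ℝ → ℝ) (A S₁ S₂ W D X₁ X₂ X₃ : ℝ × ℝ × ℝ → ℝ),
      (∀ k, f k = ∑ i, c i * Real.sin (((i : ℕ) + 1 : ℕ) * k)) →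
      (∀ p : ℝ × ℝ × ℝ, S₁ p = Real.sin ((p.2.1 - p.1) / 2)) →
      (∀ p : ℝ × ℝ × ℝ, S₂ p = Real.sin ((p.2.1 - p.2.2) / 2)) →
      (∀ p : ℝ × ℝ × ℝ, A p =
        8 * ((dispersion ω₂ p.1 * dispersion ω₂ p.2.2 +
                dispersion ω₂ p.2.1 * dispersion ω₂ (p.1 + p.2.2 - p.2.1) + 2 * (ω₂ + 2)) *
              Real.cos ((p.1 + p.2.2) / 2) -
            4 * Real.cos ((p.2.1 - p.1) / 2) * Real.cos ((p.2.2 - p.2.1) / 2)) /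
          ((dispersion ω₂ p.1 + dispersion ω₂ p.2.2 + dispersion ω₂ p.2.1 + dispersion ω₂ (p.1 + p.2.2 - p.2.1)) *
            (dispersion ω₂ p.1 * dispersion ω₂ p.2.2 +
              dispersion ω₂ p.2.1 * dispersion ω₂ (p.1 + p.2.2 - p.2.1)))) →
      (∀ p : ℝ × ℝ × ℝ, W p = vertex a b p.1 p.2.2 p.2.1 ^ 2 /
          (dispersion ω₂ p.1 * dispersion ω₂ p.2.2 * dispersion ω₂ p.2.1 * dispersion ω₂ (p.1 + p.2.2 - p.2.1)) ^ 2 *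
        (f p.1 + f p.2.2 - f p.2.1 - f (p.1 + p.2.2 - p.2.1)) ^ 2) →
      (∀ q, D q = (fderiv ℝ (fun r : ℝ × ℝ × ℝ => resonanceFn ω₂ r.1 r.2.2 r.2.1) q (1, 0, 0)) ^ 2 +
        (fderiv ℝ (fun r : ℝ × ℝ × ℝ => resonanceFn ω₂ r.1 r.2.2 r.2.1) q (0, 1, 0)) ^ 2 +
        (fderiv ℝ (fun r : ℝ × ℝ × ℝ => resonanceFn ω₂ r.1 r.2.2 r.2.1) q (0, 0, 1)) ^ 2) →
      (∀ q, X₁ q = fderiv ℝ (fun r : ℝ × ℝ × ℝ => resonanceFn ω₂ r.1 r.2.2 r.2.1) q (1, 0, 0) / D q) →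
      (∀ q, X₂ q = fderiv ℝ (fun r : ℝ × ℝ × ℝ => resonanceFn ω₂ r.1 r.2.2 r.2.1) q (0, 1, 0) / D q) →
      (∀ q, X₃ q = fderiv ℝ (fun r : ℝ × ℝ × ℝ => resonanceFn ω₂ r.1 r.2.2 r.2.1) q (0, 0, 1) / D q) →
      (∃ K η₀ : ℝ, 0 ≤ K ∧ 0 < η₀ ∧ η₀ ≤ 1 ∧ ∀ η : ℝ, 0 < η → η ≤ η₀ → ∃ Θ LG : ℝ × ℝ × ℝ → ℝ,
        ContDiff ℝ 2 Θ ∧ (∀ p, 0 ≤ Θ p ∧ Θ p ≤ 1) ∧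
        (∀ q : ℝ × ℝ × ℝ, Θ (q + (2 * Real.pi, 0, 0)) = Θ q) ∧ (∀ q : ℝ × ℝ × ℝ, Θ (q + (0, 2 * Real.pi, 0)) = Θ q) ∧
        (∀ q : ℝ × ℝ × ℝ, Θ (q + (0, 0, 2 * Real.pi)) = Θ q) ∧
        (∀ p : ℝ × ℝ × ℝ, (S₁ p ^ 2 + A p ^ 2 < η ^ 2 ∨ S₂ p ^ 2 + A p ^ 2 < η ^ 2 ∨ S₁ p ^ 2 + S₂ p ^ 2 < η ^ 2 ∨
            (1 - Real.cos p.1) + (1 - Real.cos p.2.2) + (1 + Real.cos p.2.1) < η ^ 2 ∨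
            (1 + Real.cos p.1) + (1 + Real.cos p.2.2) + (1 - Real.cos p.2.1) < η ^ 2) → Θ =ᶠ[𝓝 p] 0) ∧
        (∀ p : ℝ × ℝ × ℝ, 4 * η ^ 2 ≤ S₁ p ^ 2 + A p ^ 2 → 4 * η ^ 2 ≤ S₂ p ^ 2 + A p ^ 2 →
            4 * η ^ 2 ≤ S₁ p ^ 2 + S₂ p ^ 2 →
            4 * η ^ 2 ≤ (1 - Real.cos p.1) + (1 - Real.cos p.2.2) + (1 + Real.cos p.2.1) →
            4 * η ^ 2 ≤ (1 + Real.cos p.1) + (1 + Real.cos p.2.2) + (1 - Real.cos p.2.1) → Θ p = 1) ∧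
        (∀ q, LG q = fderiv ℝ (fun r => W r * Θ r * X₁ r) q (1, 0, 0) +
          fderiv ℝ (fun r => W r * Θ r * X₂ r) q (0, 1, 0) + fderiv ℝ (fun r => W r * Θ r * X₃ r) q (0, 0, 1)) ∧
        (∀ p, |fderiv ℝ (fun q => LG q * X₁ q) p (1, 0, 0) + fderiv ℝ (fun q => LG q * X₂ q) p (0, 1, 0) +
          fderiv ℝ (fun q => LG q * X₃ q) p (0, 0, 1)| ≤ K / η ^ 2)) →
      ∃ C α : ℝ, 0 < α ∧ ∀ δ : ℝ, 0 < δ → ∀ φ : ℝ → ℝ, Continuous φ → (∀ x, |φ x| ≤ 1) →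
        |∫ p, W p * (2 * φ (resonanceFn ω₂ p.1 p.2.2 p.2.1) - φ (resonanceFn ω₂ p.1 p.2.2 p.2.1 + δ) -
              φ (resonanceFn ω₂ p.1 p.2.2 p.2.1 - δ))
          ∂((volume.restrict (Set.Ioc (-Real.pi) Real.pi)).prod
            ((volume.restrict (Set.Ioc (-Real.pi) Real.pi)).prod
              (volume.restrict (Set.Ioc (-Real.pi) Real.pi))))| ≤ C * δ ^ (1 + α) := by
  intro ω₂ a b hω M c f A S₁ S₂ W D X₁ X₂ X₃ hf hS₁ hS₂ hA hW hD hX₁ hX₂ hX₃ hC6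
  obtain ⟨K, η₀, hK, hη₀, hη₀1, hfam⟩ := hC6
  have hπ := Real.pi_pos
  set Ω : ℝ × ℝ × ℝ → ℝ := fun r => resonanceFn ω₂ r.1 r.2.2 r.2.1 with hΩ
  set μc : Measure (ℝ × ℝ × ℝ) := (volume.restrict (Set.Ioc (-Real.pi) Real.pi)).prod
      ((volume.restrict (Set.Ioc (-Real.pi) Real.pi)).prod (volume.restrict (Set.Ioc (-Real.pi) Real.pi))) with hμc
  -- the profile
  have hfdef : f = fun k : ℝ => ∑ i, c i * Real.sin (((i : ℕ) + 1 : ℕ) * k) := funext hf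
  have hfC2 : ContDiff ℝ 2 f := by rw [hfdef]; exact fgr_contDiff_sinePoly M c 2
  have hfper : Function.Periodic f (2 * Real.pi) := by rw [hfdef]; exact fgr_periodic_sinePoly M c
  -- regularity of `Ω`, `W`, `A`
  have hΩ3 : ContDiff ℝ 3 Ω := resonanceFn_cell_contDiff ω₂ hω 3
  have hWfun : W = fun p : ℝ × ℝ × ℝ => vertex a b p.1 p.2.2 p.2.1 ^ 2 /
      (dispersion ω₂ p.1 * dispersion ω₂ p.2.2 * dispersion ω₂ p.2.1 * dispersion ω₂ (p.1 + p.2.2 - p.2.1)) ^ 2 *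
      (f p.1 + f p.2.2 - f p.2.1 - f (p.1 + p.2.2 - p.2.1)) ^ 2 := funext hW
  have hWC2 : ContDiff ℝ 2 W := by rw [hWfun]; exact excursionWeight_contDiff ω₂ a b hω 2 f hfC2
  have hWc : Continuous W := hWC2.continuous
  have hW0 : ∀ p, 0 ≤ W p := fun p => by rw [hW]; exact excursionWeight_nonneg ω₂ a b f p
  have hAc : Continuous A := (resonance_contDiff_A hω hA 0).continuous
  -- the constants of the discarded mass
  obtain ⟨CW, hCW0, hCW⟩ := weight_structure_bounds ω₂ a b hω M c f S₁ S₂ W hf hS₁ hS₂ hW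
    ![(1, 0, 0), (0, 1, 0), (0, 0, 1)] (fun i => by fin_cases i <;> simp)
  obtain ⟨Kc, hKc0, hKc⟩ := weight_corner_bounds ω₂ a b hω M c f W hf hW ![(1, 0, 0), (0, 1, 0), (0, 0, 1)]
  obtain ⟨C₁, hC₁⟩ := cellMeasure_tube_comoving_fst_le ω₂ hω A hA
  obtain ⟨C₂, hC₂⟩ := cellMeasure_tube_comoving_snd_le ω₂ hω A hA
  set Kt : ℝ := max (max C₁ C₂) 0 with hKt
  have hKt0 : 0 ≤ Kt := le_max_right _ _
  have hKt1 : C₁ ≤ Kt := (le_max_left _ _).trans (le_max_left _ _)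
  have hKt2 : C₂ ≤ Kt := (le_max_right _ _).trans (le_max_left _ _)
  have hWS : ∀ p : ℝ × ℝ × ℝ, W p ≤ CW * (Real.sin ((p.2.1 - p.1) / 2) ^ 2 * Real.sin ((p.2.1 - p.2.2) / 2) ^ 2) :=
    fun p => by
      have h := (hCW p 0 0).1
      rw [hS₁, hS₂] at h
      exact (le_abs_self _).trans h
  have hT₁ : ∀ η : ℝ, 0 < η → μc {p : ℝ × ℝ × ℝ | Real.sin ((p.2.1 - p.1) / 2) ^ 2 + A p ^ 2 < η ^ 2} ≤
      ENNReal.ofReal (Kt * η ^ 2) := fun η hη =>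
    (hC₁ η hη).trans (ENNReal.ofReal_le_ofReal (mul_le_mul_of_nonneg_right hKt1 (sq_nonneg η)))
  have hT₂ : ∀ η : ℝ, 0 < η → μc {p : ℝ × ℝ × ℝ | Real.sin ((p.2.1 - p.2.2) / 2) ^ 2 + A p ^ 2 < η ^ 2} ≤
      ENNReal.ofReal (Kt * η ^ 2) := fun η hη =>
    (hC₂ η hη).trans (ENNReal.ofReal_le_ofReal (mul_le_mul_of_nonneg_right hKt2 (sq_nonneg η)))
  obtain ⟨Cd, hCd0, hdisc⟩ := discard_integral_le A W CW Kc Kt 4 hAc hWc hCW0 hKc0 hKt0 (by norm_num) hW0 hWS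
    (fun p => (hKc p).1) (fun p => (hKc p).2.1) hT₁ hT₂
  -- apply the abstract cube theorem
  refine cube_secondDiff_of_cutoffFamily Ω W D X₁ X₂ X₃ K Cd η₀ (∫ p, W p ∂μc) hΩ3
    (fun p => resonanceFn_cell_periodic_fst ω₂ p) (fun p => resonanceFn_cell_periodic_mid ω₂ p)
    (fun p => resonanceFn_cell_periodic_snd ω₂ p) hWc hW0 hD hX₁ hX₂ hX₃ hη₀ hη₀1 hK hCd0 le_rfl ?_
  intro η hη hηle
  obtain ⟨Θ, LG, hΘC, hΘ01, P1, P2, P3, hzero, hone, hLG, hsup⟩ := hfam η hη hηle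
  have hη1 : η ≤ 1 := hηle.trans hη₀1
  -- periodicity of `W`
  obtain ⟨W1, W2, W3⟩ : (∀ p : ℝ × ℝ × ℝ, W (p.1 + 2 * Real.pi, p.2.1, p.2.2) = W p) ∧
      (∀ p : ℝ × ℝ × ℝ, W (p.1, p.2.1 + 2 * Real.pi, p.2.2) = W p) ∧
      (∀ p : ℝ × ℝ × ℝ, W (p.1, p.2.1, p.2.2 + 2 * Real.pi) = W p) := by
    refine ⟨fun p => ?_, fun p => ?_, fun p => ?_⟩
    · rw [hW, hW]; exact (excursionWeight_periodic ω₂ a b f hfper p).1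
    · rw [hW, hW]; exact (excursionWeight_periodic ω₂ a b f hfper p).2.1
    · rw [hW, hW]; exact (excursionWeight_periodic ω₂ a b f hfper p).2.2
  have T1 : ∀ p : ℝ × ℝ × ℝ, Θ (p.1 + 2 * Real.pi, p.2.1, p.2.2) = Θ p := fun p => by
    have : ((p.1 + 2 * Real.pi, p.2.1, p.2.2) : ℝ × ℝ × ℝ) = p + (2 * Real.pi, 0, 0) := by ext <;> simp
    rw [this, P1]
  have T2 : ∀ p : ℝ × ℝ × ℝ, Θ (p.1, p.2.1 + 2 * Real.pi, p.2.2) = Θ p := fun p => by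
    have : ((p.1, p.2.1 + 2 * Real.pi, p.2.2) : ℝ × ℝ × ℝ) = p + (0, 2 * Real.pi, 0) := by ext <;> simp
    rw [this, P2]
  have T3 : ∀ p : ℝ × ℝ × ℝ, Θ (p.1, p.2.1, p.2.2 + 2 * Real.pi) = Θ p := fun p => by
    have : ((p.1, p.2.1, p.2.2 + 2 * Real.pi) : ℝ × ℝ × ℝ) = p + (0, 0, 2 * Real.pi) := by ext <;> simp
    rw [this, P3]
  refine ⟨Θ, LG, hΘ01, hWC2.mul hΘC, fun p => by rw [W1, T1], fun p => by rw [W2, T2], fun p => by rw [W3, T3],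
    fun p hDp => ?_, hLG, hsup, ?_⟩
  · -- `D p = 0` forces some `ρₖ(p) = 0 < η²`, hence `Θ ≡ 0` near `p`
    have hsum : (fderiv ℝ (fun q : ℝ × ℝ × ℝ => resonanceFn ω₂ q.1 q.2.2 q.2.1) p (1, 0, 0)) ^ 2 +
        (fderiv ℝ (fun q : ℝ × ℝ × ℝ => resonanceFn ω₂ q.1 q.2.2 q.2.1) p (0, 1, 0)) ^ 2 +
        (fderiv ℝ (fun q : ℝ × ℝ × ℝ => resonanceFn ω₂ q.1 q.2.2 q.2.1) p (0, 0, 1)) ^ 2 = 0 := by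
      rw [← hD]; exact hDp
    have hη2 : 0 < η ^ 2 := by positivity
    have hcase := cutoff_arguments_zero ω₂ hω A S₁ S₂ hS₁ hS₂ hA p hsum
    have hΘ0 : Θ =ᶠ[𝓝 p] 0 := by
      refine hzero p ?_
      rcases hcase with h | h | h | h | h
      · exact Or.inl (by rw [h]; exact hη2)
      · exact Or.inr (Or.inl (by rw [h]; exact hη2))
      · exact Or.inr (Or.inr (Or.inl (by rw [h]; exact hη2)))
      · exact Or.inr (Or.inr (Or.inr (Or.inl (by rw [h]; exact hη2))))
      · exact Or.inr (Or.inr (Or.inr (Or.inr (by rw [h]; exact hη2))))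
    filter_upwards [hΘ0] with q hq
    simp only [Pi.zero_apply] at hq ⊢
    rw [hq, mul_zero]
  · -- the discarded mass
    refine hdisc η hη hη1 Θ hΘ01 fun p h1 h2 h3 h4 h5 => hone p ?_ ?_ ?_ h4 h5
    · rw [hS₁]; exact h1
    · rw [hS₂]; exact h2
    · rw [hS₁, hS₂]; exact h3


/-- **Stub B1b″ from the sup bound (C6) alone (registered sub-goal `stub_excursionSecondDifference_of_supBound`).** If
for all data of the stub the sup-bound package (C6, in the shape of the last hypothesis of `excursionCube_of_supBound`)
is available, then the registered stub `stub_excursionSecondDifference` of line `kinetic-polymer-gas-on-the-time-axis`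
holds verbatim (`stub_excursionSecondDifference_of_cube`, p151714, ∘ `excursionCube_of_supBound`). [folklore] -/
theorem stub_excursionSecondDifference_of_supBound :
    (∀ ω₂ a b : ℝ, 0 < ω₂ → ∀ (M : ℕ) (c : Fin M → ℝ) (f : ℝ → ℝ) (A S₁ S₂ W D X₁ X₂ X₃ : ℝ × ℝ × ℝ → ℝ),
        (∀ k, f k = ∑ i, c i * Real.sin (((i : ℕ) + 1 : ℕ) * k)) →
        (∀ p : ℝ × ℝ × ℝ, S₁ p = Real.sin ((p.2.1 - p.1) / 2)) →
        (∀ p : ℝ × ℝ × ℝ, S₂ p = Real.sin ((p.2.1 - p.2.2) / 2)) →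
        (∀ p : ℝ × ℝ × ℝ, A p =
          8 * ((dispersion ω₂ p.1 * dispersion ω₂ p.2.2 +
                  dispersion ω₂ p.2.1 * dispersion ω₂ (p.1 + p.2.2 - p.2.1) + 2 * (ω₂ + 2)) *
                Real.cos ((p.1 + p.2.2) / 2) -
              4 * Real.cos ((p.2.1 - p.1) / 2) * Real.cos ((p.2.2 - p.2.1) / 2)) /
            ((dispersion ω₂ p.1 + dispersion ω₂ p.2.2 + dispersion ω₂ p.2.1 + dispersion ω₂ (p.1 + p.2.2 - p.2.1)) *
              (dispersion ω₂ p.1 * dispersion ω₂ p.2.2 +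
                dispersion ω₂ p.2.1 * dispersion ω₂ (p.1 + p.2.2 - p.2.1)))) →
        (∀ p : ℝ × ℝ × ℝ, W p = vertex a b p.1 p.2.2 p.2.1 ^ 2 /
            (dispersion ω₂ p.1 * dispersion ω₂ p.2.2 * dispersion ω₂ p.2.1 * dispersion ω₂ (p.1 + p.2.2 - p.2.1)) ^ 2 *
          (f p.1 + f p.2.2 - f p.2.1 - f (p.1 + p.2.2 - p.2.1)) ^ 2) →
        (∀ q, D q = (fderiv ℝ (fun r : ℝ × ℝ × ℝ => resonanceFn ω₂ r.1 r.2.2 r.2.1) q (1, 0, 0)) ^ 2 +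
          (fderiv ℝ (fun r : ℝ × ℝ × ℝ => resonanceFn ω₂ r.1 r.2.2 r.2.1) q (0, 1, 0)) ^ 2 +
          (fderiv ℝ (fun r : ℝ × ℝ × ℝ => resonanceFn ω₂ r.1 r.2.2 r.2.1) q (0, 0, 1)) ^ 2) →
        (∀ q, X₁ q = fderiv ℝ (fun r : ℝ × ℝ × ℝ => resonanceFn ω₂ r.1 r.2.2 r.2.1) q (1, 0, 0) / D q) →
        (∀ q, X₂ q = fderiv ℝ (fun r : ℝ × ℝ × ℝ => resonanceFn ω₂ r.1 r.2.2 r.2.1) q (0, 1, 0) / D q) →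
        (∀ q, X₃ q = fderiv ℝ (fun r : ℝ × ℝ × ℝ => resonanceFn ω₂ r.1 r.2.2 r.2.1) q (0, 0, 1) / D q) →
        (∃ K η₀ : ℝ, 0 ≤ K ∧ 0 < η₀ ∧ η₀ ≤ 1 ∧ ∀ η : ℝ, 0 < η → η ≤ η₀ → ∃ Θ LG : ℝ × ℝ × ℝ → ℝ,
          ContDiff ℝ 2 Θ ∧ (∀ p, 0 ≤ Θ p ∧ Θ p ≤ 1) ∧
          (∀ q : ℝ × ℝ × ℝ, Θ (q + (2 * Real.pi, 0, 0)) = Θ q) ∧ (∀ q : ℝ × ℝ × ℝ, Θ (q + (0, 2 * Real.pi, 0)) = Θ q) ∧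
          (∀ q : ℝ × ℝ × ℝ, Θ (q + (0, 0, 2 * Real.pi)) = Θ q) ∧
          (∀ p : ℝ × ℝ × ℝ, (S₁ p ^ 2 + A p ^ 2 < η ^ 2 ∨ S₂ p ^ 2 + A p ^ 2 < η ^ 2 ∨ S₁ p ^ 2 + S₂ p ^ 2 < η ^ 2 ∨
              (1 - Real.cos p.1) + (1 - Real.cos p.2.2) + (1 + Real.cos p.2.1) < η ^ 2 ∨
              (1 + Real.cos p.1) + (1 + Real.cos p.2.2) + (1 - Real.cos p.2.1) < η ^ 2) → Θ =ᶠ[𝓝 p] 0) ∧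
          (∀ p : ℝ × ℝ × ℝ, 4 * η ^ 2 ≤ S₁ p ^ 2 + A p ^ 2 → 4 * η ^ 2 ≤ S₂ p ^ 2 + A p ^ 2 →
              4 * η ^ 2 ≤ S₁ p ^ 2 + S₂ p ^ 2 →
              4 * η ^ 2 ≤ (1 - Real.cos p.1) + (1 - Real.cos p.2.2) + (1 + Real.cos p.2.1) →
              4 * η ^ 2 ≤ (1 + Real.cos p.1) + (1 + Real.cos p.2.2) + (1 - Real.cos p.2.1) → Θ p = 1) ∧
          (∀ q, LG q = fderiv ℝ (fun r => W r * Θ r * X₁ r) q (1, 0, 0) +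
            fderiv ℝ (fun r => W r * Θ r * X₂ r) q (0, 1, 0) + fderiv ℝ (fun r => W r * Θ r * X₃ r) q (0, 0, 1)) ∧
          (∀ p, |fderiv ℝ (fun q => LG q * X₁ q) p (1, 0, 0) + fderiv ℝ (fun q => LG q * X₂ q) p (0, 1, 0) +
            fderiv ℝ (fun q => LG q * X₃ q) p (0, 0, 1)| ≤ K / η ^ 2))) →
    ∀ ω₂ a b : ℝ, 0 < ω₂ → ∀ f : ℝ → ℝ,
      (∃ (M : ℕ) (c : Fin M → ℝ), f = fun k => ∑ i, c i * Real.sin (((i : ℕ) + 1 : ℕ) * k)) →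
      ∃ C α : ℝ, 0 < α ∧ ∀ δ : ℝ, 0 < δ → ∀ φ : ℝ → ℝ, ContDiff ℝ 2 φ → (∀ x, |φ x| ≤ 1) →
        |∫ x, (2 * φ x - φ (x + δ) - φ (x - δ))
            ∂(MeasureTheory.Measure.map (fun p : ℝ × ℝ × ℝ => resonanceFn ω₂ p.1 p.2.2 p.2.1)
              (((volume.restrict (Set.Ioc (-Real.pi) Real.pi)).prod
                  ((volume.restrict (Set.Ioc (-Real.pi) Real.pi)).prod
                    (volume.restrict (Set.Ioc (-Real.pi) Real.pi)))).withDensity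
                (fun p : ℝ × ℝ × ℝ => ENNReal.ofReal
                  (vertex a b p.1 p.2.2 p.2.1 ^ 2 /
                      (dispersion ω₂ p.1 * dispersion ω₂ p.2.2 * dispersion ω₂ p.2.1 *
                        dispersion ω₂ (p.1 + p.2.2 - p.2.1)) ^ 2 *
                    (f p.1 + f p.2.2 - f p.2.1 - f (p.1 + p.2.2 - p.2.1)) ^ 2))))| ≤
          C * δ ^ (1 + α) := by
  intro hC6 ω₂ a b hω f hf
  obtain ⟨M, c, hfeq⟩ := hf
  have hfc : Continuous f := by rw [hfeq]; exact (fgr_contDiff_sinePoly M c 0).continuous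
  refine stub_excursionSecondDifference_of_cube ω₂ a b hω f hfc ?_
  have h := excursionCube_of_supBound ω₂ a b hω M c f
    (fun p => 8 * ((dispersion ω₂ p.1 * dispersion ω₂ p.2.2 +
                dispersion ω₂ p.2.1 * dispersion ω₂ (p.1 + p.2.2 - p.2.1) + 2 * (ω₂ + 2)) *
              Real.cos ((p.1 + p.2.2) / 2) -
            4 * Real.cos ((p.2.1 - p.1) / 2) * Real.cos ((p.2.2 - p.2.1) / 2)) /
          ((dispersion ω₂ p.1 + dispersion ω₂ p.2.2 + dispersion ω₂ p.2.1 + dispersion ω₂ (p.1 + p.2.2 - p.2.1)) *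
            (dispersion ω₂ p.1 * dispersion ω₂ p.2.2 +
              dispersion ω₂ p.2.1 * dispersion ω₂ (p.1 + p.2.2 - p.2.1))))
    (fun p => Real.sin ((p.2.1 - p.1) / 2)) (fun p => Real.sin ((p.2.1 - p.2.2) / 2))
    (fun p => vertex a b p.1 p.2.2 p.2.1 ^ 2 /
          (dispersion ω₂ p.1 * dispersion ω₂ p.2.2 * dispersion ω₂ p.2.1 * dispersion ω₂ (p.1 + p.2.2 - p.2.1)) ^ 2 *
        (f p.1 + f p.2.2 - f p.2.1 - f (p.1 + p.2.2 - p.2.1)) ^ 2)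
    (fun q => (fderiv ℝ (fun r : ℝ × ℝ × ℝ => resonanceFn ω₂ r.1 r.2.2 r.2.1) q (1, 0, 0)) ^ 2 +
        (fderiv ℝ (fun r : ℝ × ℝ × ℝ => resonanceFn ω₂ r.1 r.2.2 r.2.1) q (0, 1, 0)) ^ 2 +
        (fderiv ℝ (fun r : ℝ × ℝ × ℝ => resonanceFn ω₂ r.1 r.2.2 r.2.1) q (0, 0, 1)) ^ 2)
    (fun q => fderiv ℝ (fun r : ℝ × ℝ × ℝ => resonanceFn ω₂ r.1 r.2.2 r.2.1) q (1, 0, 0) /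
      ((fderiv ℝ (fun r : ℝ × ℝ × ℝ => resonanceFn ω₂ r.1 r.2.2 r.2.1) q (1, 0, 0)) ^ 2 +
        (fderiv ℝ (fun r : ℝ × ℝ × ℝ => resonanceFn ω₂ r.1 r.2.2 r.2.1) q (0, 1, 0)) ^ 2 +
        (fderiv ℝ (fun r : ℝ × ℝ × ℝ => resonanceFn ω₂ r.1 r.2.2 r.2.1) q (0, 0, 1)) ^ 2))
    (fun q => fderiv ℝ (fun r : ℝ × ℝ × ℝ => resonanceFn ω₂ r.1 r.2.2 r.2.1) q (0, 1, 0) /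
      ((fderiv ℝ (fun r : ℝ × ℝ × ℝ => resonanceFn ω₂ r.1 r.2.2 r.2.1) q (1, 0, 0)) ^ 2 +
        (fderiv ℝ (fun r : ℝ × ℝ × ℝ => resonanceFn ω₂ r.1 r.2.2 r.2.1) q (0, 1, 0)) ^ 2 +
        (fderiv ℝ (fun r : ℝ × ℝ × ℝ => resonanceFn ω₂ r.1 r.2.2 r.2.1) q (0, 0, 1)) ^ 2))
    (fun q => fderiv ℝ (fun r : ℝ × ℝ × ℝ => resonanceFn ω₂ r.1 r.2.2 r.2.1) q (0, 0, 1) /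
      ((fderiv ℝ (fun r : ℝ × ℝ × ℝ => resonanceFn ω₂ r.1 r.2.2 r.2.1) q (1, 0, 0)) ^ 2 +
        (fderiv ℝ (fun r : ℝ × ℝ × ℝ => resonanceFn ω₂ r.1 r.2.2 r.2.1) q (0, 1, 0)) ^ 2 +
        (fderiv ℝ (fun r : ℝ × ℝ × ℝ => resonanceFn ω₂ r.1 r.2.2 r.2.1) q (0, 0, 1)) ^ 2))
    (fun k => by rw [hfeq]) (fun _ => rfl) (fun _ => rfl) (fun _ => rfl) (fun _ => rfl) (fun _ => rfl) (fun _ => rfl)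
    (fun _ => rfl) (fun _ => rfl)
    (hC6 ω₂ a b hω M c f _ _ _ _ _ _ _ _ (fun k => by rw [hfeq]) (fun _ => rfl) (fun _ => rfl) (fun _ => rfl)
      (fun _ => rfl) (fun _ => rfl) (fun _ => rfl) (fun _ => rfl) (fun _ => rfl))
  simpa using h

end Summit.AtomisticToContinuum.FouriersLaw.Theorems.DrudeDissolution.KineticPolymerGasOnTheTimeAxis

end
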